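import Summits.BirchSwinnertonDyer.Rank1Residual.JET.CarrierReadingRecordsKit
import HarnessLib

/-!
# BSD rank-≤1 residual cell, lane class X11b (`3 ∥ N`: MULTIPLICATIVE at `3`, `ρ̄_{E,3}` onto), rank ONE, Tamagawa-OBSTRUCTED with ONE carrier
# prime: `BSD(E,3)` PER CELL through the JET lane's R-IDX kit doors `JET.bsdp_of_jetRowA3_tam_min` / `_tamX_min` (carrier `q ≠ 3`, READING
# binder K1) and `JET.bsdp_of_jetRowB3_tam_min` (carrier `3`, READING binder K3) on a two-engine HEEGNER-INDEX line in a DEEP field — records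
# 10 (x11c GEN 36 «J1-REMAINDER / KOLY-R»)

HONEST FRAMING (cell `b2b-bsdres-*`, verbatim): prove what is provable now; shrink each hard class to its core with data; no claim beyond
stated classes; COMBINATION classes deleted from PUBLISHED theorems only, CONSTRUCTION-shaped remainder typed; this is not "finishing BSD".
X4 / X11b (and X11 ∧ r = 1 ∧ p = 3) stay CONSTRUCTION-SHAPED; everything here is PER CELL; no lane verdict is changed; NO named fact is
introduced (debt 0) and NO definition; nothing is booked by this file (bookings are referee A's, pub-bsdpct); Cremona's numbers (`r_an`,
`#Ш_an`, models, generators, `∏ c_ℓ`, torsion, optimality / Manin codes, the galrep datum) and the Kurihara lane's per-prime tables are INPUTS.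

Unit `b2b-bsdres-x11c`, GEN 36 (prover-b2b-bsdres-x11c-g36-0), move «J1-REMAINDER / KOLY-R». POPULATION (`HOME/b2b-bsdres-x11c/gen36/pop/`:
`census36.py` over referee A's ROUND 983 state of record × the Kurihara lane's sweep records × Cremona, then `build_pop36.py`): EVERY live
residue cell on the Kolyvagin / Jetchev road classes (X4, X7, X8, X11a, X11b), BOTH ranks, odd `p`, whose shape is KOLY (`ρ̄_{E,p}` onto,
`p ∤ #E(ℚ)_tors·∏c·#Ш_an`: 30 cells) or J1 (onto, `p ∤ #E(ℚ)_tors·#Ш_an`, exactly ONE prime `q ∣ N` with `p ∣ c_q`: 171 cells; the two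
J1 cells whose carrier is an ADDITIVE `p` have no door and are excluded) — 199 cells on 191 classes (188 of them with this cell as their ONLY
open cell): 82 rank-one `(3, X11b)`, 59 `(5, X4)` + 2 `(7, X4)` (rank one 19 / rank zero 42), 26 `(3, X4)` J1 (1 / 25), 20 `(3, X4)` KOLY
(6 / 14), 10 KOLY at `p ≥ 5`. The lane never certified them: at rank one its Heegner fields (`|D| ≤ 1511`) read `ord_p [E(K):ℤy_K] = w + 1`
or found no admissible field; at rank zero (additive `p`) no Heegner-index line was ever run. THIS UNIT ran the cell's engines VERBATIM in
DEEPER fields: engine 1 = gen 3 `engine1_cha1b/main.py` = x9-g7 `jobD1b.py` (cypari2, sha256 `69e29ec7…`; rank-one mode: Cremona's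
generator, `hy = L'(E,1)·L(E^D,1)·√|D|/(4·Area)`, `m = √(4·hy/ĥ(P))`; rank-zero mode: the rank-one twist `F = E^D`, a point `x ∈ F(ℚ)` by
`ellrank`, saturated, `hy = L(E,1)·L'(F,1)·√|D|/(4·Area)`, `m = √(4·hy/ĥ(x))` — Miller 2011 Thm. 4.1 / Cor. 4.8; `NDISC 16`, `DBOUND 6000`);
engine 2 = gen 3 `run_cert.py` (`1b54bb20…`) + `e2lib.py` + `tate_stdlib.py` (stdlib re-implementation: `m`, `ord_p m` must be EQUAL,
discrete checks); twist values = additive-p1 `twistvals/main.py` (`e501b988…`). Kit jobs: see HOME/b2b-bsdres-x11c/gen36/harvest/JOBS-gen36.txt. Evidence `HOME/b2b-bsdres-x11c/gen36/`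
(POP36.md, ROWS36-TABLE.md, harvest outputs with inputs.sha256, SHA256SUMS); REPORT.md §45.

THE ROAD (cell `bsd-jet`'s R-IDX grammar, the doors referee A priced at pub-bsdpct ROUNDS 409 / 516 / 600 and booked this unit's
JDEEP rows on at ROUND 890): Jetchev 2008 Thm. 1.4 / Cor. 1.5 READ at the ONE Tamagawa carrier — READING binder K1
`JET.JetchevDivisibilityCarrierNe` (p459625; carrier `q ≠ p`) or K3 `JET.JetchevDivisibilityCarrierMult` (p463660; carrier `q = p` split
multiplicative), both `@[conjecture]` typed readings CONSUMED AS HYPOTHESES (nothing about K1 / K3 is asserted here) — + McCallum 1991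
Cor. 5.6 (`hMcU`), GZK (`hGZK`), Kolyvagin / Gross–Zagier bookkeeping (`hKo`, `hrec`, `hD36`, `hlev`): with `w = ord_p c_q` at the carrier
and a Heegner field `K` in which `ord_p [E(K):ℤy_K] ≤ w`, `Ш(E/ℚ)[p] = 0`, and with `ord_p #Ш_an = 0`, Miller's `BSD(E,p)`.
IN THE KERNEL per cell (`decide` / `norm_num` goals of ONE kit application): the literal Cremona model (`Δ ≠ 0`; global minimality by the
factored Kraus criterion `Supersingular.isGloballyMinimal_of_krausCriterion₃_factored` on the COMPLETE factorisation of `|Δ|`); `ρ̄_{E,p}`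
ONTO (Serre 1972: three Prop-19 witnesses at `p ≥ 5` / an irreducible Frobenius + a Frobenius of order `3` at `p = 3`; the `p`-adic tower
inside the door: Serre IV-23 at `p ≥ 5`, the Tate line at a multiplicative `3`, ONE Frobenius witness mod `9` otherwise); at a
multiplicative `3`: `3 ∣ Δ`, `3 ∤ c₄`; the carrier's Tamagawa number from ONE `TamLocal` (split `I_n`) or exact `TamX` (`IV` / `IV*`)
certificate (n1011-p03's bridges `Additive.IntModelTam.localTamagawaNumber_padic_eq_of_intModel_of_tamLocal` / `_of_tamX`) and
`w ≤ ord_p c_q`. DISPLAYED (hypotheses of every record): `hJ` (READING), `hMcU`, `hGZK`, `hKo`, `hrec`, `hD36`, `hlev`; the Heegner datum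
(`K` imaginary quadratic, `d_K ∉ {−3, −4}`, Heegner hypothesis for the level `N`, `P` a Heegner point of infinite order), bucket A: `q ∣ N`;
the INDEX LINE `hv : ord_p [E(K):ℤP] ≤ w` — THIS UNIT's two-engine deep-field datum, quoted per docstring, NOT re-computed here —;
`hr : r_an ≤ 1`; `hs` / `hvs` : `#Ш_an` a `p`-adic unit (Cremona; exact at rank 0).
What a record is worth is the referee's call (EVIDENCE-grade certificate under displayed binders, as every Heegner-index record of the
cell). Cells in this file: `474474bi1`@3, `475734l1`@3, `475860l1`@3, `481992b1`@3, `487410bs1`@3, `487560n1`@3, `487578bi1`@3.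

References: D. Jetchev, Compos. Math. 144 (2008) Thm. 1.4, Cor. 1.5 [Jetchev2008]; W. McCallum, LMS LN 153 (1991) §1, Cor. 5.6
[McCallumLMS1991]; B. H. Gross, LMS LN 153 (1991) Prop. 2.1 [GrossLMS1991]; V. A. Kolyvagin (1990) [KolyvaginEulerSystems1990];
J.-P. Serre, Invent. Math. 15 (1972) §2.4 Prop. 15, §2.8 Prop. 19 [Serre1972]; J.-P. Serre, *Abelian ℓ-adic representations* IV-23
[SerreAbelianLadic1968]; B. H. Gross, D. Zagier, Invent. Math. 84 (1986) [GrossZagier1986]; R. L. Miller, LMS J. Comput. Math. 14 (2011)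
Thm. 4.1, Cor. 4.8, Def. 1.1 [Miller2011LMS]; C. Wuthrich, Doc. Math. 19 (2014) Lemma 20 [Wuthrich2014]; J. H. Silverman, *AEC* (2009)
VII.1, VII.5 [SilvermanAEC2009], *ATAEC* (1994) IV.9.4 [SilvermanATAEC1994]; A. Kraus, Acta Arith. 54 (1989) [Kraus1989]; Cremona's
tables [Cremona2006].
-/

set_option autoImplicit false

noncomputable section

open scoped Classical

open WeierstrassCurve Literature.NumberTheory.EllipticCurves
  Literature.NumberTheory.EllipticCurves.ModularForms
  Literature.NumberTheory.EllipticCurves.Rank1Residual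
  Literature.NumberTheory.EllipticCurves.Rank1Residual.Typed
  Literature.NumberTheory.EllipticCurves.Rank1Residual.X11RankOneCertificates
  Summit.BirchSwinnertonDyer.BirchSwinnertonDyer.Rank1Residual
  Summit.BirchSwinnertonDyer.BirchSwinnertonDyer.Rank1Residual.IntModel
  Summit.BirchSwinnertonDyer.BirchSwinnertonDyer.Rank1Residual.X11RankOne
  Summit.BirchSwinnertonDyer.BirchSwinnertonDyer.Rank2Observatory.Tam
  Summit.BirchSwinnertonDyer.Rank1Residual.JET

namespace Summit.BirchSwinnertonDyer.Rank1Residual.X11b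

/-- **`BSD(E,3)` for `474474bi1`** (cell `(474474bi1, 3)`, class X11b, rank 1; JET grammar key `JETB:474474bi1@3`, bucket B at `p = 3 ∥ N`, carrier
`3` (door `JET.bsdp_of_jetRowB3_tam_min`)); `N = 474474 = 2·3·7·11·13·79`, split `I39` at `3`, `r_an = 1`, `#E(ℚ)_tors = 1`, `∏c = 1794`, `#Ш_an =
1`, Cremona galrep: no code at this prime (`ρ̄_{E,3}` onto); `|Δ| = ∏` over `[(2, 23), (3, 39), (7, 2), (11, 1), (13, 1), (79, 1)]` (factored Kraus
criterion, every disjunct decided). The ONE carrier: carrier `q = 3` (split `I39`, `c_q = 39`, `w = ord_3 c_q = 1`; IN THE KERNEL by the `TamLocal`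
certificate `⟨3, 1, 1, 0, 0, 0, 0, 39, 0, 0, 39⟩`); READING binder `hJ` = K3 `JetchevDivisibilityCarrierMult`; displayed index line `hv : ord_3
[E(K):ℤP] ≤ 1`. Serre Prop-15 witnesses mod `3`: `(ℓ, #Ẽ(𝔽_ℓ))` = `(5, 10)` (`X² − aX + ℓ` root-free over `𝔽₃`), `(103, 114)` (`ℓ ≡ 1`, `a ≡ 2 (mod
3)`, `9 ∤ #Ẽ`). Kurihara lane note of record: «multiplicative p, r=1, irr (Castella 2018 Thm A withdrawn for p||N)». State of record (referee A
ROUND 983, `scratchA_A_state_after_x4gh_add3_onA2R977_fold.pkl`): class `residue`, 1 open cell(s), register empty. Other engine-1 fields tried (`D`: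
`m` (`ord_3 m`)): `-503`: `m = 10764` (`ord = 2`); `-1847`: `m = 10764` (`ord = 2`); `-2903`: `m = 14352` (`ord = 1`); `-3071`: `m = 3588` (`ord =
1`); `-3695`: `m = 14352` (`ord = 1`); `-5183`: `m = 17940` (`ord = 1`); `-5255`: `m = 14352` (`ord = 1`). THIS UNIT'S DATUM (displayed, NOT
re-computed here): DEEP FIELD `K = ℚ(√-1559)` (`1559` = prime): **`m = [E(K):ℤy_K] = 7176`, `ord_3 m = 1`** (`ρ = m²/4`, `L'(E,1) = 9.2513102449`,
`L(E^D,1) = 3.6777688965`, `ĥ(P) = 0.3030099736`; Cremona's generator) — engine 1 j293228 = engine 2 j293889: `m = 7176` EQUAL (AGREE v_p(m)=1, dev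
≤ 6.5e-15); twist `E^D` (j293892): `N = 1153200041994`, `#tors·∏c·#Ш_an = 1·3588·4`, `ord_3 #Ш_an(E^D) = 0`, `ord_3 ∏c(E^D) = 1` (BSD-consistent).
CONDITIONAL on every binder; per cell; nothing booked by this file.
[cite: Jetchev2008, Thm. 1.4 and Cor. 1.5 (p. 812)] [cite: McCallumLMS1991, Cor. 5.6] [cite: Serre1972, §2.4 Prop. 15, §2.8 Prop. 19] [cite: Cremona2006, Table 1 (label 474474bi1)] -/
theorem bsdpJD_474474bi1_3
    (hJ : JetchevDivisibilityCarrierMult)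
    (hMcU : McCallum1991_padicValNat_card_sha_primary_add_le_of_globalDivisibility)
    (hGZK : rank_eq_analyticRank_of_analyticRank_le_one)
    (hKo : ∀ (N : ℕ) [NeZero N] (W : WeierstrassCurve ℚ) (K : Type) [Field K] [NumberField K], kolyvagin N W K)
    (hrec : ∀ (N : ℕ) [NeZero N] (W : WeierstrassCurve ℚ) (K : Type) [Field K] [NumberField K],
      heegnerPointOfConductor_one_galoisConj N W K)
    (hD36 : ∀ (N : ℕ) [NeZero N] (W : WeierstrassCurve ℚ) (K : Type) [Field K] [NumberField K],
      phi_heegnerTau_mem_singularModuliField N W K)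
    (hlev : ∀ {N : ℕ} [NeZero N], IsNewformOf.level_eq_conductorNorm (N := N))
    (W : WeierstrassCurve ℚ) (hW : W = ⟨1, 0, 0, 503094000, 208666713989376⟩)
    {N : ℕ} [NeZero N] {K : Type} [Field K] [NumberField K] (hK : IsImaginaryQuadratic K)
    (hD3 : NumberField.discr K ≠ -3) (hD4 : NumberField.discr K ≠ -4)
    (hH : SatisfiesHeegnerHypothesis N K) {P : (W.baseChange K).toAffine.Point}
    (hP : IsHeegnerPoint N W K P) (hnt : ¬ IsOfFinAddOrder P)
    (hv : padicValNat 3 (AddSubgroup.zmultiples P).index ≤ 1)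
    (hr : W.analyticRank ≤ 1) {s : ℚ} (hs : shaAn W = (s : ℂ)) (hvs : padicValRat 3 s = 0) : BSDp W 3 :=
  bsdp_of_jetRowB3_tam_min 1 0 0 503094000 208666713989376
    (Supersingular.isGloballyMinimal_of_krausCriterion₃_factored 1 0 0 503094000 208666713989376 [(2, 23), (3, 39), (7, 2), (11, 1), (13, 1), (79, 1)] (by decide +kernel)
      (by intro t ht; fin_cases ht <;> norm_num) (by decide +kernel))
    (by decide +kernel) (by decide +kernel)
    5 103 (by norm_num) (by norm_num) (by decide) (by decide) (by decide) (by decide) (by decide +kernel) (by decide +kernel)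
    (n₁ := 10) (n₂ := 114) (by decide +kernel) (by decide +kernel) (by decide) (by decide) (by decide) (by decide)
    ⟨3, 1, 1, 0, 0, 0, 0, 39, 0, 0, 39⟩ rfl (by decide +kernel) (c := 39) (by decide +kernel) (w := 1) (by decide +kernel)
    hJ hMcU hGZK hKo hrec hD36 hlev W hW hK hD3 hD4 hH hP hnt hv hr hs hvs

/-- **`BSD(E,3)` for `475734l1`** (cell `(475734l1, 3)`, class X11b, rank 1; JET grammar key `JETA:475734l1@3`, bucket A at `p = 3 ∥ N` (door
`JET.bsdp_of_jetRowA3_tam_min`)); `N = 475734 = 2·3·7·47·241`, nonsplit `I1` at `3`, `r_an = 1`, `#E(ℚ)_tors = 1`, `∏c = 3`, `#Ш_an = 1`, Cremona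
galrep: no code at this prime (`ρ̄_{E,3}` onto); `|Δ| = ∏` over `[(2, 3), (3, 1), (7, 1), (47, 1), (241, 1)]` (factored Kraus criterion, every
disjunct decided). The ONE carrier: carrier `q = 2` (split `I3`, `c_q = 3`, `w = ord_3 c_q = 1`; IN THE KERNEL by the `TamLocal` certificate `⟨2, 1,
1, 0, 0, 0, 0, 3, 0, 0, 3⟩`); READING binder `hJ` = K1 `JetchevDivisibilityCarrierNe`; displayed index line `hv : ord_3 [E(K):ℤP] ≤ 1`. Serre
Prop-15 witnesses mod `3`: `(ℓ, #Ẽ(𝔽_ℓ))` = `(5, 5)` (`X² − aX + ℓ` root-free over `𝔽₃`), `(19, 24)` (`ℓ ≡ 1`, `a ≡ 2 (mod 3)`, `9 ∤ #Ẽ`). Kurihara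
lane note of record: «multiplicative p, r=1, irr (Castella 2018 Thm A withdrawn for p||N)». State of record (referee A ROUND 983,
`scratchA_A_state_after_x4gh_add3_onA2R977_fold.pkl`): class `residue`, 1 open cell(s), register empty. Other engine-1 fields tried (`D`: `m`
(`ord_3 m`)): `-839`: `m = 18` (`ord = 2`); `-887`: `m = 36` (`ord = 2`); `-1151`: `m = 36` (`ord = 2`); `-1487`: `m = 18` (`ord = 2`); `-1727`: `m
= 6` (`ord = 1`); `-2015`: `m = 24` (`ord = 1`); `-2159`: `m = 6` (`ord = 1`); `-2663`: `m = 54` (`ord = 3`); `-2831`: `m = 96` (`ord = 1`);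
`-2999`: `m = 30` (`ord = 1`); `-3695`: `m = 42` (`ord = 1`); `-3743`: `m = 12` (`ord = 1`); `-4343`: `m = 6` (`ord = 1`). THIS UNIT'S DATUM
(displayed, NOT re-computed here): DEEP FIELD `K = ℚ(√-1655)` (`1655` = 5·331): **`m = [E(K):ℤy_K] = 30`, `ord_3 m = 1`** (`ρ = m²/4`, `L'(E,1) =
13.965640048`, `L(E^D,1) = 3.5480227083`, `ĥ(P) = 1.8845337831`; Cremona's generator) — engine 1 j293234 = engine 2 j294330: `m = 30` EQUAL (AGREE
v_p(m)=1, dev ≤ 7.0e-14); twist `E^D` (j294332): `N = 1303047319350`, `#tors·∏c·#Ш_an = 1·6·25`, `ord_3 #Ш_an(E^D) = 0`, `ord_3 ∏c(E^D) = 1`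
(BSD-consistent). CONDITIONAL on every binder; per cell; nothing booked by this file.
[cite: Jetchev2008, Thm. 1.4 and Cor. 1.5 (p. 812)] [cite: McCallumLMS1991, Cor. 5.6] [cite: Serre1972, §2.4 Prop. 15, §2.8 Prop. 19] [cite: Cremona2006, Table 1 (label 475734l1)] -/
theorem bsdpJD_475734l1_3
    (hJ : JetchevDivisibilityCarrierNe)
    (hMcU : McCallum1991_padicValNat_card_sha_primary_add_le_of_globalDivisibility)
    (hGZK : rank_eq_analyticRank_of_analyticRank_le_one)
    (hKo : ∀ (N : ℕ) [NeZero N] (W : WeierstrassCurve ℚ) (K : Type) [Field K] [NumberField K], kolyvagin N W K)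
    (hrec : ∀ (N : ℕ) [NeZero N] (W : WeierstrassCurve ℚ) (K : Type) [Field K] [NumberField K],
      heegnerPointOfConductor_one_galoisConj N W K)
    (hD36 : ∀ (N : ℕ) [NeZero N] (W : WeierstrassCurve ℚ) (K : Type) [Field K] [NumberField K],
      phi_heegnerTau_mem_singularModuliField N W K)
    (hlev : ∀ {N : ℕ} [NeZero N], IsNewformOf.level_eq_conductorNorm (N := N))
    (W : WeierstrassCurve ℚ) (hW : W = ⟨1, 1, 1, -35, 89⟩)
    {N : ℕ} [NeZero N] {K : Type} [Field K] [NumberField K] (hK : IsImaginaryQuadratic K)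
    (hD3 : NumberField.discr K ≠ -3) (hD4 : NumberField.discr K ≠ -4)
    (hH : SatisfiesHeegnerHypothesis N K) {P : (W.baseChange K).toAffine.Point}
    (hP : IsHeegnerPoint N W K P) (hnt : ¬ IsOfFinAddOrder P) (hqN : 2 ∣ N)
    (hv : padicValNat 3 (AddSubgroup.zmultiples P).index ≤ 1)
    (hr : W.analyticRank ≤ 1) {s : ℚ} (hs : shaAn W = (s : ℂ)) (hvs : padicValRat 3 s = 0) : BSDp W 3 :=
  bsdp_of_jetRowA3_tam_min 1 1 1 (-35) 89
    (Supersingular.isGloballyMinimal_of_krausCriterion₃_factored 1 1 1 (-35) 89 [(2, 3), (3, 1), (7, 1), (47, 1), (241, 1)] (by decide +kernel)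
      (by intro t ht; fin_cases ht <;> norm_num) (by decide +kernel))
    (by decide +kernel) (by decide +kernel)
    5 19 (by norm_num) (by norm_num) (by decide) (by decide) (by decide) (by decide) (by decide +kernel) (by decide +kernel)
    (n₁ := 5) (n₂ := 24) (by decide +kernel) (by decide +kernel) (by decide) (by decide) (by decide) (by decide)
    2 ⟨2, 1, 1, 0, 0, 0, 0, 3, 0, 0, 3⟩ rfl (by decide +kernel) (c := 3) (by decide +kernel) (w := 1) (by decide +kernel) (by decide)
    hJ hMcU hGZK hKo hrec hD36 hlev W hW hK hD3 hD4 hH hP hnt hqN hv hr hs hvs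

/-- **`BSD(E,3)` for `475860l1`** (cell `(475860l1, 3)`, class X11b, rank 1; JET grammar key `JETA:475860l1@3`, bucket A at `p = 3 ∥ N` (door
`JET.bsdp_of_jetRowA3_tamX_min`)); `N = 475860 = 2^2·3·5·7·11·103`, split `I1` at `3`, `r_an = 1`, `#E(ℚ)_tors = 2`, `∏c = 24`, `#Ш_an = 1`, Cremona
galrep: no code at this prime (`ρ̄_{E,3}` onto); `|Δ| = ∏` over `[(2, 4), (3, 1), (5, 8), (7, 10), (11, 4), (103, 1)]` (factored Kraus criterion,
every disjunct decided). The ONE carrier: carrier `q = 2` ADDITIVE of type `IV` (`c_q = 3`, `w = ord_3 c_q = 1`; IN THE KERNEL by the exact `TamX`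
certificate `⟨2, 1, 1, 1, 0, 1, 4, 0⟩`); READING binder `hJ` = K1 `JetchevDivisibilityCarrierNe`; displayed index line `hv : ord_3 [E(K):ℤP] ≤ 1`.
Serre Prop-15 witnesses mod `3`: `(ℓ, #Ẽ(𝔽_ℓ))` = `(29, 28)` (`X² − aX + ℓ` root-free over `𝔽₃`), `(13, 12)` (`ℓ ≡ 1`, `a ≡ 2 (mod 3)`, `9 ∤ #Ẽ`).
Kurihara lane note of record: «multiplicative p, r=1, irr (Castella 2018 Thm A withdrawn for p||N)». State of record (referee A ROUND 983,
`scratchA_A_state_after_x4gh_add3_onA2R977_fold.pkl`): class `residue`, 1 open cell(s), register ('MANIN-DB', 'tail'), ('MANIN-DB', 103),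
('MANIN-DB', 11), ('MANIN-DB', 5), ('MANIN-DB', 7). FLAG `opt-code-2` (Cremona optimality code 2; `ρ̄_{E,3}` onto forbids a `3`-isogeny in the
class, so `ord_3` of the index is class-invariant; the reading stands if the optimal curve's Manin constant is prime to `3`). Other engine-1 fields
tried (`D`: `m` (`ord_3 m`)): `-479`: `m = 72` (`ord = 2`); `-2351`: `m = 24` (`ord = 1`); `-2999`: `m = 72` (`ord = 2`); `-3071`: `m = 48` (`ord =
1`); `-4919`: `m = 288` (`ord = 2`); `-5759`: `m = 96` (`ord = 1`). THIS UNIT'S DATUM (displayed, NOT re-computed here): DEEP FIELD `K = ℚ(√-1679)`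
(`1679` = 23·73): **`m = [E(K):ℤy_K] = 24`, `ord_3 m = 1`** (`ρ = m²/4`, `L'(E,1) = 9.5625024191`, `L(E^D,1) = 0.0194906742`, `ĥ(P) = 14.485038547`;
Cremona's generator) — engine 1 j293239 = engine 2 j294065: `m = 24` EQUAL (AGREE v_p(m)=1, dev ≤ 4.2e-13); twist `E^D` (j294066): `N =
1341468850260`, `#tors·∏c·#Ш_an = 2·96·1`, `ord_3 #Ш_an(E^D) = 0`, `ord_3 ∏c(E^D) = 1` (BSD-consistent). CONDITIONAL on every binder; per cell;
nothing booked by this file.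
[cite: Jetchev2008, Thm. 1.4 and Cor. 1.5 (p. 812)] [cite: McCallumLMS1991, Cor. 5.6] [cite: Serre1972, §2.4 Prop. 15, §2.8 Prop. 19] [cite: Cremona2006, Table 1 (label 475860l1)] -/
theorem bsdpJD_475860l1_3
    (hJ : JetchevDivisibilityCarrierNe)
    (hMcU : McCallum1991_padicValNat_card_sha_primary_add_le_of_globalDivisibility)
    (hGZK : rank_eq_analyticRank_of_analyticRank_le_one)
    (hKo : ∀ (N : ℕ) [NeZero N] (W : WeierstrassCurve ℚ) (K : Type) [Field K] [NumberField K], kolyvagin N W K)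
    (hrec : ∀ (N : ℕ) [NeZero N] (W : WeierstrassCurve ℚ) (K : Type) [Field K] [NumberField K],
      heegnerPointOfConductor_one_galoisConj N W K)
    (hD36 : ∀ (N : ℕ) [NeZero N] (W : WeierstrassCurve ℚ) (K : Type) [Field K] [NumberField K],
      phi_heegnerTau_mem_singularModuliField N W K)
    (hlev : ∀ {N : ℕ} [NeZero N], IsNewformOf.level_eq_conductorNorm (N := N))
    (W : WeierstrassCurve ℚ) (hW : W = ⟨0, 1, 0, -423676561, 3356457421160⟩)
    {N : ℕ} [NeZero N] {K : Type} [Field K] [NumberField K] (hK : IsImaginaryQuadratic K)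
    (hD3 : NumberField.discr K ≠ -3) (hD4 : NumberField.discr K ≠ -4)
    (hH : SatisfiesHeegnerHypothesis N K) {P : (W.baseChange K).toAffine.Point}
    (hP : IsHeegnerPoint N W K P) (hnt : ¬ IsOfFinAddOrder P) (hqN : 2 ∣ N)
    (hv : padicValNat 3 (AddSubgroup.zmultiples P).index ≤ 1)
    (hr : W.analyticRank ≤ 1) {s : ℚ} (hs : shaAn W = (s : ℂ)) (hvs : padicValRat 3 s = 0) : BSDp W 3 :=
  bsdp_of_jetRowA3_tamX_min 0 1 0 (-423676561) 3356457421160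
    (Supersingular.isGloballyMinimal_of_krausCriterion₃_factored 0 1 0 (-423676561) 3356457421160 [(2, 4), (3, 1), (5, 8), (7, 10), (11, 4), (103, 1)] (by decide +kernel)
      (by intro t ht; fin_cases ht <;> norm_num) (by decide +kernel))
    (by decide +kernel) (by decide +kernel)
    29 13 (by norm_num) (by norm_num) (by decide) (by decide) (by decide) (by decide) (by decide +kernel) (by decide +kernel)
    (n₁ := 28) (n₂ := 12) (by decide +kernel) (by decide +kernel) (by decide) (by decide) (by decide) (by decide)
    2 (by norm_num) ⟨2, 1, 1, 1, 0, 1, 4, 0⟩ rfl (by decide +kernel) (w := 1) (by decide +kernel) (by decide)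
    hJ hMcU hGZK hKo hrec hD36 hlev W hW hK hD3 hD4 hH hP hnt hqN hv hr hs hvs

/-- **`BSD(E,3)` for `481992b1`** (cell `(481992b1, 3)`, class X11b, rank 1; JET grammar key `JETB:481992b1@3`, bucket B at `p = 3 ∥ N`, carrier `3`
(door `JET.bsdp_of_jetRowB3_tam_min`)); `N = 481992 = 2^3·3·7·19·151`, split `I9` at `3`, `r_an = 1`, `#E(ℚ)_tors = 1`, `∏c = 9`, `#Ш_an = 1`,
Cremona galrep: no code at this prime (`ρ̄_{E,3}` onto); `|Δ| = ∏` over `[(2, 11), (3, 9), (7, 1), (19, 1), (151, 1)]` (factored Kraus criterion,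
every disjunct decided). The ONE carrier: carrier `q = 3` (split `I9`, `c_q = 9`, `w = ord_3 c_q = 2`; IN THE KERNEL by the `TamLocal` certificate
`⟨3, 1, 1, 2, 0, 0, 0, 9, 0, 0, 9⟩`); READING binder `hJ` = K3 `JetchevDivisibilityCarrierMult`; displayed index line `hv : ord_3 [E(K):ℤP] ≤ 2`.
Serre Prop-15 witnesses mod `3`: `(ℓ, #Ẽ(𝔽_ℓ))` = `(17, 13)` (`X² − aX + ℓ` root-free over `𝔽₃`), `(79, 84)` (`ℓ ≡ 1`, `a ≡ 2 (mod 3)`, `9 ∤ #Ẽ`).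
Kurihara lane note of record: «multiplicative p, r=1, irr (Castella 2018 Thm A withdrawn for p||N)». State of record (referee A ROUND 983,
`scratchA_A_state_after_x4gh_add3_onA2R977_fold.pkl`): class `residue`, 1 open cell(s), register empty. Other engine-1 fields tried (`D`: `m`
(`ord_3 m`)): `-143`: `m = 54` (`ord = 3`); `-887`: `m = 54` (`ord = 3`); `-983`: `m = 54` (`ord = 3`); `-1343`: `m = 36` (`ord = 2`); `-1895`: `m =
216` (`ord = 3`); `-1991`: `m = 72` (`ord = 2`); `-2663`: `m = 54` (`ord = 3`); `-2687`: `m = 162` (`ord = 4`); `-3023`: `m = 18` (`ord = 2`);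
`-3071`: `m = 216` (`ord = 3`); `-3167`: `m = 108` (`ord = 3`); `-3335`: `m = 108` (`ord = 3`). THIS UNIT'S DATUM (displayed, NOT re-computed here):
DEEP FIELD `K = ℚ(√-1319)` (`1319` = prime): **`m = [E(K):ℤy_K] = 18`, `ord_3 m = 2`** (`ρ = m²/4`, `L'(E,1) = 12.309211345`, `L(E^D,1) =
0.1961991728`, `ĥ(P) = 1.9136356370`; Cremona's generator) — engine 1 j293228 = engine 2 j293889: `m = 18` EQUAL (AGREE v_p(m)=2, dev ≤ 3.9e-14);
twist `E^D` (j293892): `N = 838550883912`, `#tors·∏c·#Ш_an = 1·9·1`, `ord_3 #Ш_an(E^D) = 0`, `ord_3 ∏c(E^D) = 2` (BSD-consistent). CONDITIONAL on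
every binder; per cell; nothing booked by this file.
[cite: Jetchev2008, Thm. 1.4 and Cor. 1.5 (p. 812)] [cite: McCallumLMS1991, Cor. 5.6] [cite: Serre1972, §2.4 Prop. 15, §2.8 Prop. 19] [cite: Cremona2006, Table 1 (label 481992b1)] -/
theorem bsdpJD_481992b1_3
    (hJ : JetchevDivisibilityCarrierMult)
    (hMcU : McCallum1991_padicValNat_card_sha_primary_add_le_of_globalDivisibility)
    (hGZK : rank_eq_analyticRank_of_analyticRank_le_one)
    (hKo : ∀ (N : ℕ) [NeZero N] (W : WeierstrassCurve ℚ) (K : Type) [Field K] [NumberField K], kolyvagin N W K)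
    (hrec : ∀ (N : ℕ) [NeZero N] (W : WeierstrassCurve ℚ) (K : Type) [Field K] [NumberField K],
      heegnerPointOfConductor_one_galoisConj N W K)
    (hD36 : ∀ (N : ℕ) [NeZero N] (W : WeierstrassCurve ℚ) (K : Type) [Field K] [NumberField K],
      phi_heegnerTau_mem_singularModuliField N W K)
    (hlev : ∀ {N : ℕ} [NeZero N], IsNewformOf.level_eq_conductorNorm (N := N))
    (W : WeierstrassCurve ℚ) (hW : W = ⟨0, 1, 0, -2448, -18144⟩)
    {N : ℕ} [NeZero N] {K : Type} [Field K] [NumberField K] (hK : IsImaginaryQuadratic K)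
    (hD3 : NumberField.discr K ≠ -3) (hD4 : NumberField.discr K ≠ -4)
    (hH : SatisfiesHeegnerHypothesis N K) {P : (W.baseChange K).toAffine.Point}
    (hP : IsHeegnerPoint N W K P) (hnt : ¬ IsOfFinAddOrder P)
    (hv : padicValNat 3 (AddSubgroup.zmultiples P).index ≤ 2)
    (hr : W.analyticRank ≤ 1) {s : ℚ} (hs : shaAn W = (s : ℂ)) (hvs : padicValRat 3 s = 0) : BSDp W 3 :=
  bsdp_of_jetRowB3_tam_min 0 1 0 (-2448) (-18144)
    (Supersingular.isGloballyMinimal_of_krausCriterion₃_factored 0 1 0 (-2448) (-18144) [(2, 11), (3, 9), (7, 1), (19, 1), (151, 1)] (by decide +kernel)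
      (by intro t ht; fin_cases ht <;> norm_num) (by decide +kernel))
    (by decide +kernel) (by decide +kernel)
    17 79 (by norm_num) (by norm_num) (by decide) (by decide) (by decide) (by decide) (by decide +kernel) (by decide +kernel)
    (n₁ := 13) (n₂ := 84) (by decide +kernel) (by decide +kernel) (by decide) (by decide) (by decide) (by decide)
    ⟨3, 1, 1, 2, 0, 0, 0, 9, 0, 0, 9⟩ rfl (by decide +kernel) (c := 9) (by decide +kernel) (w := 2) (by decide +kernel)
    hJ hMcU hGZK hKo hrec hD36 hlev W hW hK hD3 hD4 hH hP hnt hv hr hs hvs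

/-- **`BSD(E,3)` for `487410bs1`** (cell `(487410bs1, 3)`, class X11b, rank 1; JET grammar key `JETA:487410bs1@3`, bucket A at `p = 3 ∥ N` (door
`JET.bsdp_of_jetRowA3_tam_min`)); `N = 487410 = 2·3·5·7·11·211`, split `I4` at `3`, `r_an = 1`, `#E(ℚ)_tors = 2`, `∏c = 96`, `#Ш_an = 1`, Cremona
galrep: no code at this prime (`ρ̄_{E,3}` onto); `|Δ| = ∏` over `[(2, 6), (3, 4), (5, 5), (7, 2), (11, 4), (211, 1)]` (factored Kraus criterion,
every disjunct decided). The ONE carrier: carrier `q = 2` (split `I6`, `c_q = 6`, `w = ord_3 c_q = 1`; IN THE KERNEL by the `TamLocal` certificate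
`⟨2, 1, 1, 0, 0, 0, 0, 6, 0, 0, 6⟩`); READING binder `hJ` = K1 `JetchevDivisibilityCarrierNe`; displayed index line `hv : ord_3 [E(K):ℤP] ≤ 1`.
Serre Prop-15 witnesses mod `3`: `(ℓ, #Ẽ(𝔽_ℓ))` = `(17, 16)` (`X² − aX + ℓ` root-free over `𝔽₃`), `(61, 60)` (`ℓ ≡ 1`, `a ≡ 2 (mod 3)`, `9 ∤ #Ẽ`).
Kurihara lane note of record: «multiplicative p, r=1, irr (Castella 2018 Thm A withdrawn for p||N)». State of record (referee A ROUND 983,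
`scratchA_A_state_after_x4gh_add3_onA2R977_fold.pkl`): class `residue`, 1 open cell(s), register empty. FLAG `opt-code-2` (Cremona optimality code
2; `ρ̄_{E,3}` onto forbids a `3`-isogeny in the class, so `ord_3` of the index is class-invariant; the reading stands if the optimal curve's Manin
constant is prime to `3`). Other engine-1 fields tried (`D`: `m` (`ord_3 m`)): `-479`: `m = 288` (`ord = 2`); `-4199`: `m = 192` (`ord = 1`);
`-5519`: `m = 480` (`ord = 1`). THIS UNIT'S DATUM (displayed, NOT re-computed here): DEEP FIELD `K = ℚ(√-1679)` (`1679` = 23·73): **`m = [E(K):ℤy_K]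
= 96`, `ord_3 m = 1`** (`ρ = m²/4`, `L'(E,1) = 14.907957371`, `L(E^D,1) = 1.7699373330`, `ĥ(P) = 3.0723308855`; Cremona's generator) — engine 1
j293234 = engine 2 j294330: `m = 96` EQUAL (AGREE v_p(m)=1, dev ≤ 5.3e-14); twist `E^D` (j294332): `N = 1374028773810`, `#tors·∏c·#Ш_an = 2·768·1`,
`ord_3 #Ш_an(E^D) = 0`, `ord_3 ∏c(E^D) = 1` (BSD-consistent). CONDITIONAL on every binder; per cell; nothing booked by this file.
[cite: Jetchev2008, Thm. 1.4 and Cor. 1.5 (p. 812)] [cite: McCallumLMS1991, Cor. 5.6] [cite: Serre1972, §2.4 Prop. 15, §2.8 Prop. 19] [cite: Cremona2006, Table 1 (label 487410bs1)] -/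
theorem bsdpJD_487410bs1_3
    (hJ : JetchevDivisibilityCarrierNe)
    (hMcU : McCallum1991_padicValNat_card_sha_primary_add_le_of_globalDivisibility)
    (hGZK : rank_eq_analyticRank_of_analyticRank_le_one)
    (hKo : ∀ (N : ℕ) [NeZero N] (W : WeierstrassCurve ℚ) (K : Type) [Field K] [NumberField K], kolyvagin N W K)
    (hrec : ∀ (N : ℕ) [NeZero N] (W : WeierstrassCurve ℚ) (K : Type) [Field K] [NumberField K],
      heegnerPointOfConductor_one_galoisConj N W K)
    (hD36 : ∀ (N : ℕ) [NeZero N] (W : WeierstrassCurve ℚ) (K : Type) [Field K] [NumberField K],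
      phi_heegnerTau_mem_singularModuliField N W K)
    (hlev : ∀ {N : ℕ} [NeZero N], IsNewformOf.level_eq_conductorNorm (N := N))
    (W : WeierstrassCurve ℚ) (hW : W = ⟨1, 0, 0, -6591, -2391975⟩)
    {N : ℕ} [NeZero N] {K : Type} [Field K] [NumberField K] (hK : IsImaginaryQuadratic K)
    (hD3 : NumberField.discr K ≠ -3) (hD4 : NumberField.discr K ≠ -4)
    (hH : SatisfiesHeegnerHypothesis N K) {P : (W.baseChange K).toAffine.Point}
    (hP : IsHeegnerPoint N W K P) (hnt : ¬ IsOfFinAddOrder P) (hqN : 2 ∣ N)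
    (hv : padicValNat 3 (AddSubgroup.zmultiples P).index ≤ 1)
    (hr : W.analyticRank ≤ 1) {s : ℚ} (hs : shaAn W = (s : ℂ)) (hvs : padicValRat 3 s = 0) : BSDp W 3 :=
  bsdp_of_jetRowA3_tam_min 1 0 0 (-6591) (-2391975)
    (Supersingular.isGloballyMinimal_of_krausCriterion₃_factored 1 0 0 (-6591) (-2391975) [(2, 6), (3, 4), (5, 5), (7, 2), (11, 4), (211, 1)] (by decide +kernel)
      (by intro t ht; fin_cases ht <;> norm_num) (by decide +kernel))
    (by decide +kernel) (by decide +kernel)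
    17 61 (by norm_num) (by norm_num) (by decide) (by decide) (by decide) (by decide) (by decide +kernel) (by decide +kernel)
    (n₁ := 16) (n₂ := 60) (by decide +kernel) (by decide +kernel) (by decide) (by decide) (by decide) (by decide)
    2 ⟨2, 1, 1, 0, 0, 0, 0, 6, 0, 0, 6⟩ rfl (by decide +kernel) (c := 6) (by decide +kernel) (w := 1) (by decide +kernel) (by decide)
    hJ hMcU hGZK hKo hrec hD36 hlev W hW hK hD3 hD4 hH hP hnt hqN hv hr hs hvs

/-- **`BSD(E,3)` for `487560n1`** (cell `(487560n1, 3)`, class X11b, rank 1; JET grammar key `JETB:487560n1@3`, bucket B at `p = 3 ∥ N`, carrier `3`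
(door `JET.bsdp_of_jetRowB3_tam_min`)); `N = 487560 = 2^3·3·5·17·239`, split `I6` at `3`, `r_an = 1`, `#E(ℚ)_tors = 2`, `∏c = 96`, `#Ш_an = 1`,
Cremona galrep: no code at this prime (`ρ̄_{E,3}` onto); `|Δ| = ∏` over `[(2, 8), (3, 6), (5, 2), (17, 2), (239, 1)]` (factored Kraus criterion,
every disjunct decided). The ONE carrier: carrier `q = 3` (split `I6`, `c_q = 6`, `w = ord_3 c_q = 1`; IN THE KERNEL by the `TamLocal` certificate
`⟨3, 1, 1, 2, 0, 0, 0, 6, 0, 0, 6⟩`); READING binder `hJ` = K3 `JetchevDivisibilityCarrierMult`; displayed index line `hv : ord_3 [E(K):ℤP] ≤ 1`.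
Serre Prop-15 witnesses mod `3`: `(ℓ, #Ẽ(𝔽_ℓ))` = `(13, 14)` (`X² − aX + ℓ` root-free over `𝔽₃`), `(127, 120)` (`ℓ ≡ 1`, `a ≡ 2 (mod 3)`, `9 ∤ #Ẽ`).
Kurihara lane note of record: «multiplicative p, r=1, irr (Castella 2018 Thm A withdrawn for p||N)». State of record (referee A ROUND 983,
`scratchA_A_state_after_x4gh_add3_onA2R977_fold.pkl`): class `residue`, 1 open cell(s), register ('MANIN-DB', 'tail'), ('MANIN-DB', 17),
('MANIN-DB', 239), ('MANIN-DB', 5). FLAG `opt-code-2` (Cremona optimality code 2; `ρ̄_{E,3}` onto forbids a `3`-isogeny in the class, so `ord_3` of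
the index is class-invariant; the reading stands if the optimal curve's Manin constant is prime to `3`). Other engine-1 fields tried (`D`: `m`
(`ord_3 m`)): `-791`: `m = 288` (`ord = 2`); `-1511`: `m = 96` (`ord = 1`); `-1919`: `m = 480` (`ord = 1`); `-1991`: `m = 192` (`ord = 1`); `-2711`:
`m = 96` (`ord = 1`); `-3671`: `m = 96` (`ord = 1`); `-4031`: `m = 192` (`ord = 1`); `-4271`: `m = 96` (`ord = 1`); `-4679`: `m = 96` (`ord = 1`).
THIS UNIT'S DATUM (displayed, NOT re-computed here): DEEP FIELD `K = ℚ(√-1271)` (`1271` = 31·41): **`m = [E(K):ℤy_K] = 192`, `ord_3 m = 1`** (`ρ =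
m²/4`, `L'(E,1) = 12.151150601`, `L(E^D,1) = 6.9167922334`, `ĥ(P) = 0.5389824592`; Cremona's generator) — engine 1 j293239 = engine 2 j294065: `m =
192` EQUAL (AGREE v_p(m)=1, dev ≤ 3.2e-14); twist `E^D` (j294066): `N = 787624413960`, `#tors·∏c·#Ш_an = 2·768·4`, `ord_3 #Ш_an(E^D) = 0`, `ord_3
∏c(E^D) = 1` (BSD-consistent). CONDITIONAL on every binder; per cell; nothing booked by this file.
[cite: Jetchev2008, Thm. 1.4 and Cor. 1.5 (p. 812)] [cite: McCallumLMS1991, Cor. 5.6] [cite: Serre1972, §2.4 Prop. 15, §2.8 Prop. 19] [cite: Cremona2006, Table 1 (label 487560n1)] -/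
theorem bsdpJD_487560n1_3
    (hJ : JetchevDivisibilityCarrierMult)
    (hMcU : McCallum1991_padicValNat_card_sha_primary_add_le_of_globalDivisibility)
    (hGZK : rank_eq_analyticRank_of_analyticRank_le_one)
    (hKo : ∀ (N : ℕ) [NeZero N] (W : WeierstrassCurve ℚ) (K : Type) [Field K] [NumberField K], kolyvagin N W K)
    (hrec : ∀ (N : ℕ) [NeZero N] (W : WeierstrassCurve ℚ) (K : Type) [Field K] [NumberField K],
      heegnerPointOfConductor_one_galoisConj N W K)
    (hD36 : ∀ (N : ℕ) [NeZero N] (W : WeierstrassCurve ℚ) (K : Type) [Field K] [NumberField K],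
      phi_heegnerTau_mem_singularModuliField N W K)
    (hlev : ∀ {N : ℕ} [NeZero N], IsNewformOf.level_eq_conductorNorm (N := N))
    (W : WeierstrassCurve ℚ) (hW : W = ⟨0, 1, 0, -2980, 67328⟩)
    {N : ℕ} [NeZero N] {K : Type} [Field K] [NumberField K] (hK : IsImaginaryQuadratic K)
    (hD3 : NumberField.discr K ≠ -3) (hD4 : NumberField.discr K ≠ -4)
    (hH : SatisfiesHeegnerHypothesis N K) {P : (W.baseChange K).toAffine.Point}
    (hP : IsHeegnerPoint N W K P) (hnt : ¬ IsOfFinAddOrder P)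
    (hv : padicValNat 3 (AddSubgroup.zmultiples P).index ≤ 1)
    (hr : W.analyticRank ≤ 1) {s : ℚ} (hs : shaAn W = (s : ℂ)) (hvs : padicValRat 3 s = 0) : BSDp W 3 :=
  bsdp_of_jetRowB3_tam_min 0 1 0 (-2980) 67328
    (Supersingular.isGloballyMinimal_of_krausCriterion₃_factored 0 1 0 (-2980) 67328 [(2, 8), (3, 6), (5, 2), (17, 2), (239, 1)] (by decide +kernel)
      (by intro t ht; fin_cases ht <;> norm_num) (by decide +kernel))
    (by decide +kernel) (by decide +kernel)
    13 127 (by norm_num) (by norm_num) (by decide) (by decide) (by decide) (by decide) (by decide +kernel) (by decide +kernel)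
    (n₁ := 14) (n₂ := 120) (by decide +kernel) (by decide +kernel) (by decide) (by decide) (by decide) (by decide)
    ⟨3, 1, 1, 2, 0, 0, 0, 6, 0, 0, 6⟩ rfl (by decide +kernel) (c := 6) (by decide +kernel) (w := 1) (by decide +kernel)
    hJ hMcU hGZK hKo hrec hD36 hlev W hW hK hD3 hD4 hH hP hnt hv hr hs hvs

/-- **`BSD(E,3)` for `487578bi1`** (cell `(487578bi1, 3)`, class X11b, rank 1; JET grammar key `JETA:487578bi1@3`, bucket A at `p = 3 ∥ N` (door
`JET.bsdp_of_jetRowA3_tam_min`)); `N = 487578 = 2·3·7·13·19·47`, nonsplit `I10` at `3`, `r_an = 1`, `#E(ℚ)_tors = 2`, `∏c = 48`, `#Ш_an = 1`,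
Cremona galrep: no code at this prime (`ρ̄_{E,3}` onto); `|Δ| = ∏` over `[(2, 6), (3, 10), (7, 1), (13, 4), (19, 2), (47, 1)]` (factored Kraus
criterion, every disjunct decided). The ONE carrier: carrier `q = 2` (split `I6`, `c_q = 6`, `w = ord_3 c_q = 1`; IN THE KERNEL by the `TamLocal`
certificate `⟨2, 1, 1, 0, 0, 0, 0, 6, 0, 0, 6⟩`); READING binder `hJ` = K1 `JetchevDivisibilityCarrierNe`; displayed index line `hv : ord_3
[E(K):ℤP] ≤ 1`. Serre Prop-15 witnesses mod `3`: `(ℓ, #Ẽ(𝔽_ℓ))` = `(5, 8)` (`X² − aX + ℓ` root-free over `𝔽₃`), `(37, 48)` (`ℓ ≡ 1`, `a ≡ 2 (mod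
3)`, `9 ∤ #Ẽ`). Kurihara lane note of record: «multiplicative p, r=1, irr (Castella 2018 Thm A withdrawn for p||N)». State of record (referee A
ROUND 983, `scratchA_A_state_after_x4gh_add3_onA2R977_fold.pkl`): class `residue`, 1 open cell(s), register empty. Other engine-1 fields tried (`D`:
`m` (`ord_3 m`)): `-1895`: `m = 288` (`ord = 2`); `-5183`: `m = 384` (`ord = 1`); `-5927`: `m = 240` (`ord = 1`). THIS UNIT'S DATUM (displayed, NOT
re-computed here): DEEP FIELD `K = ℚ(√-5015)` (`5015` = 5·17·59): **`m = [E(K):ℤy_K] = 96`, `ord_3 m = 1`** (`ρ = m²/4`, `L'(E,1) = 9.7083491523`,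
`L(E^D,1) = 0.5159930143`, `ĥ(P) = 2.0247879025`; Cremona's generator) — engine 1 j293228 = engine 2 j293889: `m = 96` EQUAL (AGREE v_p(m)=1, dev ≤
1.2e-13); twist `E^D` (j293892): `N = 12262696405050`, `#tors·∏c·#Ш_an = 2·768·1`, `ord_3 #Ш_an(E^D) = 0`, `ord_3 ∏c(E^D) = 1` (BSD-consistent).
CONDITIONAL on every binder; per cell; nothing booked by this file.
[cite: Jetchev2008, Thm. 1.4 and Cor. 1.5 (p. 812)] [cite: McCallumLMS1991, Cor. 5.6] [cite: Serre1972, §2.4 Prop. 15, §2.8 Prop. 19] [cite: Cremona2006, Table 1 (label 487578bi1)] -/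
theorem bsdpJD_487578bi1_3
    (hJ : JetchevDivisibilityCarrierNe)
    (hMcU : McCallum1991_padicValNat_card_sha_primary_add_le_of_globalDivisibility)
    (hGZK : rank_eq_analyticRank_of_analyticRank_le_one)
    (hKo : ∀ (N : ℕ) [NeZero N] (W : WeierstrassCurve ℚ) (K : Type) [Field K] [NumberField K], kolyvagin N W K)
    (hrec : ∀ (N : ℕ) [NeZero N] (W : WeierstrassCurve ℚ) (K : Type) [Field K] [NumberField K],
      heegnerPointOfConductor_one_galoisConj N W K)
    (hD36 : ∀ (N : ℕ) [NeZero N] (W : WeierstrassCurve ℚ) (K : Type) [Field K] [NumberField K],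
      phi_heegnerTau_mem_singularModuliField N W K)
    (hlev : ∀ {N : ℕ} [NeZero N], IsNewformOf.level_eq_conductorNorm (N := N))
    (W : WeierstrassCurve ℚ) (hW : W = ⟨1, 1, 1, -396169, 95657591⟩)
    {N : ℕ} [NeZero N] {K : Type} [Field K] [NumberField K] (hK : IsImaginaryQuadratic K)
    (hD3 : NumberField.discr K ≠ -3) (hD4 : NumberField.discr K ≠ -4)
    (hH : SatisfiesHeegnerHypothesis N K) {P : (W.baseChange K).toAffine.Point}
    (hP : IsHeegnerPoint N W K P) (hnt : ¬ IsOfFinAddOrder P) (hqN : 2 ∣ N)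
    (hv : padicValNat 3 (AddSubgroup.zmultiples P).index ≤ 1)
    (hr : W.analyticRank ≤ 1) {s : ℚ} (hs : shaAn W = (s : ℂ)) (hvs : padicValRat 3 s = 0) : BSDp W 3 :=
  bsdp_of_jetRowA3_tam_min 1 1 1 (-396169) 95657591
    (Supersingular.isGloballyMinimal_of_krausCriterion₃_factored 1 1 1 (-396169) 95657591 [(2, 6), (3, 10), (7, 1), (13, 4), (19, 2), (47, 1)] (by decide +kernel)
      (by intro t ht; fin_cases ht <;> norm_num) (by decide +kernel))
    (by decide +kernel) (by decide +kernel)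
    5 37 (by norm_num) (by norm_num) (by decide) (by decide) (by decide) (by decide) (by decide +kernel) (by decide +kernel)
    (n₁ := 8) (n₂ := 48) (by decide +kernel) (by decide +kernel) (by decide) (by decide) (by decide) (by decide)
    2 ⟨2, 1, 1, 0, 0, 0, 0, 6, 0, 0, 6⟩ rfl (by decide +kernel) (c := 6) (by decide +kernel) (w := 1) (by decide +kernel) (by decide)
    hJ hMcU hGZK hKo hrec hD36 hlev W hW hK hD3 hD4 hH hP hnt hqN hv hr hs hvs

end Summit.BirchSwinnertonDyer.Rank1Residual.X11b

end
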